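import Summits.CriticalPhenomena.PercolationContinuityZ3.Theorems.PercNearOneGluingNoHeavyLowerTailSunflowerPartitionLemma
import Mathlib.Data.Fin.Tuple.Basic
import HarnessLib
import HarnessLib.Audit

/-!
# `NoHeavyLowerTail` (crux stmt-CriticalPhenomena-4575), abstract sunflower cubic: the MULTI-PETAL partition lemma
# (typed conjecture `PartitionLemmaK`: monotone maps into `M_k`, any number `k` of petals), its specialisation to
# `PartitionLemmaH` (`k = 3`), and RELABELLING MONOTONICITY (merging petal colours never decreases the functional)

Support file (seat `prim-l12-p2` gen 26; `--supports stmt-CriticalPhenomena-4575`).  Nothing is asserted about the crux; no `sorry`.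
Memo: run/shared/lean/prim/prim-l12/prim-l12-p2/FINDING-g26-MULTIPETAL-COMPONENT-LEMMA.md.

SETTING.  A monotone map `2^α → M_k` (`M_k` = bottom, top, and `k` pairwise incomparable petals) is the same thing as a kernel up-set
`A` and `k` up-sets `V i ⊇ A` with `V i ∩ V j ⊆ A` for `i ≠ j` (`MSunflower k α`); labels are coded in `Fin (k+2)` (`0` bottom,
`Fin.last (k+1)` top, petal `i ↦ i+1`), so that for `k = 3` the coding is literally that of `Sunflower.lab` (`Fin 5`).  The kernel
`s6K` is the clean form of `s6H`: (number of ordered (top, bottom) pairs among the three labels) − [the three labels are pairwise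
distinct]; `s6K_three : s6K 3 = s6H` (`decide`).

* `PartitionLemmaK` (★ₖ, OPEN, census-clean): `0 ≤ ZK := Σ_{ordered 3-partitions} s6K (lab P¹) (lab P²) (lab P³)` for EVERY `k`, every
  finite `α` and every `MSunflower k α`.  Equivalent `(A,B)`-form (memo §1): for an up-set `A` and a down-set `B` of `2^α` with `A ∩ B = ∅`,
  colour each connected component of the Hasse graph of the middle zone `M = 2^α ∖ (A ∪ B)` by its own petal (`MSunflower.ofColouring`;
  the finest admissible colouring); then  `2·#{ordered 3-partitions of α into blocks of A ∪ B using both A and B}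
  ≥ #{ordered 3-partitions with ≥ 2 blocks in M, all M-blocks in pairwise different components}`.
  CENSUS (memo §2, exact integer engines): ALL `(A,B)` pairs on `≤ 5` points (168 / 7 581 / 7 828 354 pairs; up to 10 components),
  restriction-monotonicity for all of them (3.9·10⁷ comparisons), 6·10⁶ random + 1.2·10⁷ annealed adversarial pairs on 6 points,
  kit j169735 (6–8 points): no negative value, minimum 0 (products).  By the cloning reduction (memo of `…SunflowerPartitionLemma`, §3b)
  ★ₖ implies the law-level CUBIC strengthening of Gladkov's strong Harris–Kleitman inequality [Gladkov, Bull. Lond. Math. Soc. 56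
  (2024), Thm 2.1: `μ(A)μ(B) ≥ e₂(μ(C_1),…,μ(C_k))` for product measures]:  `(μ(A)+μ(B))·(μ(A)μ(B) − e₂(c)) ≥ e₃(c)`, `c_i = μ(C_i)`.
* `partitionLemmaH_of_partitionLemmaK` : ★ₖ ⟹ ★ (`PartitionLemmaH`), via `MSunflower.ofSunflower` and `ZK_ofSunflower : ZK = ZH`.
* `MSunflower.relabel g` (merge petal colours along `g : Fin k → Fin k'`), `ZK_le_ZK_relabel : F.ZK ≤ (F.relabel g).ZK`: the FINEST
  petal structure is the strongest instance (coarsening only deletes negative kernel values).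
* `MSunflower.ofColouring` : the `(A, B, χ)` description (any colouring of the middle zone constant along inclusions inside it).
-/

namespace Summit.CriticalPhenomena.PercolationContinuityZ3.Theorems.SunflowerPartition

open Finset

/-! ## Labels in `Fin (k+2)` and the kernel -/

/-- Indicator of an ordered (top, bottom) pair of labels in `Fin (k+2)` (`top = Fin.last (k+1)`, `bottom = 0`). [this work] -/
def tbK (k : ℕ) (x y : Fin (k + 2)) : ℤ := if x = Fin.last (k + 1) ∧ y = 0 then 1 else 0

/-- The multi-petal kernel: number of ordered (top, bottom) pairs among the three labels minus the indicator that the three labels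
are pairwise distinct (clean form of `s6H`). [this work] -/
def s6K (k : ℕ) (x y z : Fin (k + 2)) : ℤ :=
  tbK k x y + tbK k x z + tbK k y x + tbK k y z + tbK k z x + tbK k z y - (if x ≠ y ∧ y ≠ z ∧ x ≠ z then 1 else 0)

/-- For `k = 3` the multi-petal kernel is literally `s6H`. [this work] -/
theorem s6K_three : ∀ x y z : Fin 5, s6K 3 x y z = s6H x y z := by decide

/-- The label of petal `i : Fin k` is `i + 1 : Fin (k+2)`. [this work] -/
def petalLab (k : ℕ) (i : Fin k) : Fin (k + 2) := i.succ.castSucc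

/-- A petal label is not the bottom label. [this work] -/
theorem petalLab_ne_zero (k : ℕ) (i : Fin k) : petalLab k i ≠ 0 := by
  intro h
  have := congrArg Fin.val h
  simp [petalLab] at this

/-- A petal label is not the top label. [this work] -/
theorem petalLab_ne_last (k : ℕ) (i : Fin k) : petalLab k i ≠ Fin.last (k + 1) := by
  intro h
  have h' := congrArg Fin.val h
  simp [petalLab] at h'
  omega

/-- `petalLab` is injective. [this work] -/
theorem petalLab_injective (k : ℕ) : Function.Injective (petalLab k) := by
  intro i j h
  have h' := congrArg Fin.val h
  simp [petalLab] at h'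
  exact Fin.ext h'

/-- **Pointwise relabelling comparison.**  If a relabelling of three labels preserves top-ness and bottom-ness of each label and
preserves equalities, it does not decrease the kernel. [this work] -/
theorem s6K_le_of_relabel {k k' : ℕ} {x y z : Fin (k + 2)} {x' y' z' : Fin (k' + 2)}
    (hxt : x = Fin.last (k + 1) ↔ x' = Fin.last (k' + 1)) (hx0 : x = 0 ↔ x' = 0)
    (hyt : y = Fin.last (k + 1) ↔ y' = Fin.last (k' + 1)) (hy0 : y = 0 ↔ y' = 0)
    (hzt : z = Fin.last (k + 1) ↔ z' = Fin.last (k' + 1)) (hz0 : z = 0 ↔ z' = 0)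
    (hxy : x = y → x' = y') (hxz : x = z → x' = z') (hyz : y = z → y' = z') :
    s6K k x y z ≤ s6K k' x' y' z' := by
  unfold s6K tbK
  have e1 := if_congr (x := (1 : ℤ)) (y := 0) (and_congr hxt hy0) (Eq.refl (1 : ℤ)) (Eq.refl (0 : ℤ))
  have e2 := if_congr (x := (1 : ℤ)) (y := 0) (and_congr hxt hz0) (Eq.refl (1 : ℤ)) (Eq.refl (0 : ℤ))
  have e3 := if_congr (x := (1 : ℤ)) (y := 0) (and_congr hyt hx0) (Eq.refl (1 : ℤ)) (Eq.refl (0 : ℤ))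
  have e4 := if_congr (x := (1 : ℤ)) (y := 0) (and_congr hyt hz0) (Eq.refl (1 : ℤ)) (Eq.refl (0 : ℤ))
  have e5 := if_congr (x := (1 : ℤ)) (y := 0) (and_congr hzt hx0) (Eq.refl (1 : ℤ)) (Eq.refl (0 : ℤ))
  have e6 := if_congr (x := (1 : ℤ)) (y := 0) (and_congr hzt hy0) (Eq.refl (1 : ℤ)) (Eq.refl (0 : ℤ))
  rw [e1, e2, e3, e4, e5, e6]
  have e7 : (if x' ≠ y' ∧ y' ≠ z' ∧ x' ≠ z' then (1 : ℤ) else 0) ≤ if x ≠ y ∧ y ≠ z ∧ x ≠ z then 1 else 0 := by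
    by_cases h' : x' ≠ y' ∧ y' ≠ z' ∧ x' ≠ z'
    · have h : x ≠ y ∧ y ≠ z ∧ x ≠ z :=
        ⟨fun e => h'.1 (hxy e), fun e => h'.2.1 (hyz e), fun e => h'.2.2 (hxz e)⟩
      rw [if_pos h', if_pos h]
    · rw [if_neg h']
      split_ifs <;> norm_num
  linarith

/-! ## Monotone maps into `M_k` -/

variable {α : Type*} [DecidableEq α]

/-- A monotone map `2^α → M_k`: a kernel up-set `A` and `k` petal up-sets `V i ⊇ A` whose pairwise intersections lie in `A`.
[this work] -/
structure MSunflower (k : ℕ) (α : Type*) [DecidableEq α] where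
  /-- the up-sets `V i = A ⊔ C_i` -/
  V : Fin k → Finset (Finset α)
  /-- the kernel (top cell) -/
  A : Finset (Finset α)
  /-- each `V i` is an up-set -/
  upperV : ∀ i, IsUpperSet (V i : Set (Finset α))
  /-- the kernel is an up-set -/
  upperA : IsUpperSet (A : Set (Finset α))
  /-- the kernel lies in every `V i` -/
  A_sub : ∀ i, A ⊆ V i
  /-- distinct petals meet inside the kernel -/
  inter_sub : ∀ i j, i ≠ j → V i ∩ V j ⊆ A

namespace MSunflower

variable {k : ℕ} (F : MSunflower k α)

/-- The `M_k`-valued labelling coded in `Fin (k+2)`: top on the kernel, `i+1` on the petal `V i ∖ A` (the least such `i`; it is unique),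
`0` elsewhere. [this work] -/
def lab (S : Finset α) : Fin (k + 2) :=
  if S ∈ F.A then Fin.last (k + 1)
  else if h : ∃ i, S ∈ F.V i then petalLab k (Fin.find (fun i => S ∈ F.V i) h) else 0

/-- The label is top iff the set lies in the kernel. [this work] -/
theorem lab_eq_last_iff (S : Finset α) : F.lab S = Fin.last (k + 1) ↔ S ∈ F.A := by
  unfold lab
  by_cases hA : S ∈ F.A
  · simp [hA]
  · simp only [hA, if_false, iff_false]
    split_ifs with h
    · exact petalLab_ne_last k _
    · intro h0
      have := congrArg Fin.val h0
      simp at this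

/-- The label is bottom iff the set lies neither in the kernel nor in any `V i`. [this work] -/
theorem lab_eq_zero_iff (S : Finset α) : F.lab S = 0 ↔ S ∉ F.A ∧ ∀ i, S ∉ F.V i := by
  unfold lab
  by_cases hA : S ∈ F.A
  · simp only [hA, if_true, not_true_eq_false, false_and, iff_false]
    intro h0
    have := congrArg Fin.val h0
    simp at this
  · simp only [hA, if_false, not_false_eq_true, true_and]
    split_ifs with h
    · simp only [petalLab_ne_zero, false_iff, not_forall, not_not]
      exact h
    · simp only [true_iff]
      exact fun i hi => h ⟨i, hi⟩

/-- A non-kernel set lying in `V i` has label `i+1`. [this work] -/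
theorem lab_eq_petalLab {S : Finset α} {i : Fin k} (hA : S ∉ F.A) (hi : S ∈ F.V i) : F.lab S = petalLab k i := by
  unfold lab
  rw [if_neg hA, dif_pos ⟨i, hi⟩]
  congr 1
  rw [Fin.find_eq_iff]
  refine ⟨hi, fun j hj hSj => ?_⟩
  exact hA (F.inter_sub j i (ne_of_lt hj) (mem_inter.2 ⟨hSj, hi⟩))

/-- Every label is top, bottom, or the label of a petal containing the set. [this work] -/
theorem lab_cases (S : Finset α) :
    S ∈ F.A ∨ F.lab S = 0 ∨ ∃ i, S ∉ F.A ∧ S ∈ F.V i ∧ F.lab S = petalLab k i := by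
  by_cases hA : S ∈ F.A
  · exact Or.inl hA
  by_cases hex : ∃ i, S ∈ F.V i
  · obtain ⟨i, hi⟩ := hex
    exact Or.inr (Or.inr ⟨i, hA, hi, F.lab_eq_petalLab hA hi⟩)
  · exact Or.inr (Or.inl ((F.lab_eq_zero_iff S).2 ⟨hA, fun i hi => hex ⟨i, hi⟩⟩))

variable [Fintype α]

/-- `ZK = Σ_{ordered 3-partitions} s6K` (the partition functional of the cubic row, `k` petals). [this work] -/
def ZK : ℤ := ∑ q ∈ parts α, s6K k (F.lab q.1) (F.lab q.2) (F.lab (q.1 ∪ q.2)ᶜ)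

end MSunflower

/-- **MULTI-PETAL PARTITION LEMMA** (★ₖ; this work; OPEN; census-clean — header and memo §2): for every `k`, every finite `α` and every
monotone map `2^α → M_k`, `Σ_{ordered 3-partitions} s6K ≥ 0`.  For `k = 3` it is `PartitionLemmaH`
(`partitionLemmaH_of_partitionLemmaK`); the finest petal structure is the strongest case (`MSunflower.ZK_le_ZK_relabel`).
An obligation, never a fact: use as `(h : PartitionLemmaK)`. [status: open] -/
@[conjecture] def PartitionLemmaK : Prop :=
  ∀ (k : ℕ) (α : Type) [Fintype α] [DecidableEq α] (F : MSunflower k α), 0 ≤ F.ZK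

/-! ## `k = 3`: the multi-petal functional of a `Sunflower` is `ZH` -/

namespace MSunflower

/-- A `Sunflower` (three petals) as an `MSunflower 3`. [this work] -/
def ofSunflower (F : Sunflower α) : MSunflower 3 α where
  V := F.V
  A := F.A
  upperV := F.upper
  upperA := fun _ _ hST hS => F.mem_A_of_subset hST hS
  A_sub := by
    intro i S hS
    have h01 : S ∈ F.V 0 ∩ F.V 1 := hS
    fin_cases i
    · exact (mem_inter.1 h01).1
    · exact (mem_inter.1 h01).2
    · have h02 : S ∈ F.V 0 ∩ F.V 2 := by rw [F.inter_eq 0 2 (by decide)]; exact h01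
      exact (mem_inter.1 h02).2
  inter_sub := fun i j hij S hS => by
    have h := F.inter_eq i j hij
    rw [h] at hS
    exact hS

variable [Fintype α]

omit [Fintype α] in
/-- The two labellings agree. [this work] -/
theorem lab_ofSunflower (F : Sunflower α) (S : Finset α) : (ofSunflower F).lab S = F.lab S := by
  by_cases hA : S ∈ F.A
  · rw [((ofSunflower F).lab_eq_last_iff S).2 hA]
    unfold Sunflower.lab; rw [if_pos hA]; rfl
  have hA' : S ∉ (ofSunflower F).A := hA
  by_cases h0 : S ∈ F.V 0
  · rw [(ofSunflower F).lab_eq_petalLab (i := 0) hA' h0]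
    unfold Sunflower.lab; rw [if_neg hA, if_pos h0]; rfl
  by_cases h1 : S ∈ F.V 1
  · rw [(ofSunflower F).lab_eq_petalLab (i := 1) hA' h1]
    unfold Sunflower.lab; rw [if_neg hA, if_neg h0, if_pos h1]; rfl
  by_cases h2 : S ∈ F.V 2
  · rw [(ofSunflower F).lab_eq_petalLab (i := 2) hA' h2]
    unfold Sunflower.lab; rw [if_neg hA, if_neg h0, if_neg h1, if_pos h2]; rfl
  · have hz : (ofSunflower F).lab S = 0 := ((ofSunflower F).lab_eq_zero_iff S).2 ⟨hA', by
      intro i; fin_cases i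
      · exact h0
      · exact h1
      · exact h2⟩
    rw [hz]
    unfold Sunflower.lab; rw [if_neg hA, if_neg h0, if_neg h1, if_neg h2]

/-- `ZK (ofSunflower F) = ZH F`. [this work] -/
theorem ZK_ofSunflower (F : Sunflower α) : (ofSunflower F).ZK = F.ZH := by
  unfold ZK Sunflower.ZH
  refine sum_congr rfl fun q _ => ?_
  rw [lab_ofSunflower, lab_ofSunflower, lab_ofSunflower, s6K_three]

end MSunflower

/-- **★ₖ ⟹ ★**: the multi-petal partition lemma implies `PartitionLemmaH`. [this work] -/
theorem partitionLemmaH_of_partitionLemmaK (h : PartitionLemmaK) : PartitionLemmaH := by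
  intro α _ _ F
  rw [← MSunflower.ZK_ofSunflower]
  exact h 3 α (MSunflower.ofSunflower F)

/-! ## Relabelling (merging petal colours) never decreases the functional -/

namespace MSunflower

variable {k k' : ℕ} (F : MSunflower k α) (g : Fin k → Fin k')

/-- Merge petal colours along `g : Fin k → Fin k'`: `V' j = A ∪ ⋃_{g i = j} V i`. [this work] -/
def relabel : MSunflower k' α where
  V := fun j => F.A ∪ (Finset.univ.filter fun i => g i = j).biUnion F.V
  A := F.A
  upperV := by
    intro j S T hST hS
    have hS' : S ∈ F.A ∪ (Finset.univ.filter fun i => g i = j).biUnion F.V := hS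
    show T ∈ F.A ∪ (Finset.univ.filter fun i => g i = j).biUnion F.V
    rw [mem_union, mem_biUnion] at hS' ⊢
    rcases hS' with hA | ⟨i, hi, hSi⟩
    · exact Or.inl (F.upperA hST hA)
    · exact Or.inr ⟨i, hi, F.upperV i hST hSi⟩
  upperA := F.upperA
  A_sub := fun j => subset_union_left
  inter_sub := by
    intro j j' hjj' S hS
    rw [mem_inter, mem_union, mem_union, mem_biUnion, mem_biUnion] at hS
    rcases hS with ⟨hA | ⟨i, hi, hSi⟩, hA' | ⟨i', hi', hSi'⟩⟩
    · exact hA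
    · exact hA
    · exact hA'
    · have hii' : i ≠ i' := by
        intro h; subst h
        exact hjj' ((mem_filter.1 hi).2.symm.trans (mem_filter.1 hi').2)
      exact F.inter_sub i i' hii' (mem_inter.2 ⟨hSi, hSi'⟩)

/-- Membership in a merged petal. [this work] -/
theorem mem_relabel_V {j : Fin k'} {S : Finset α} :
    S ∈ (F.relabel g).V j ↔ S ∈ F.A ∨ ∃ i, g i = j ∧ S ∈ F.V i := by
  show S ∈ F.A ∪ (Finset.univ.filter fun i => g i = j).biUnion F.V ↔ _
  rw [mem_union, mem_biUnion]
  constructor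
  · rintro (hA | ⟨i, hi, hSi⟩)
    · exact Or.inl hA
    · exact Or.inr ⟨i, (mem_filter.1 hi).2, hSi⟩
  · rintro (hA | ⟨i, hi, hSi⟩)
    · exact Or.inl hA
    · exact Or.inr ⟨i, mem_filter.2 ⟨mem_univ _, hi⟩, hSi⟩

/-- Relabelling preserves the kernel label. [this work] -/
theorem relabel_lab_eq_last_iff (S : Finset α) :
    (F.relabel g).lab S = Fin.last (k' + 1) ↔ F.lab S = Fin.last (k + 1) := by
  rw [lab_eq_last_iff, lab_eq_last_iff]; rfl

/-- Relabelling preserves the bottom label. [this work] -/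
theorem relabel_lab_eq_zero_iff (S : Finset α) : (F.relabel g).lab S = 0 ↔ F.lab S = 0 := by
  rw [lab_eq_zero_iff, lab_eq_zero_iff]
  constructor
  · rintro ⟨hA, h⟩
    refine ⟨hA, fun i hSi => h (g i) ?_⟩
    exact (F.mem_relabel_V g).2 (Or.inr ⟨i, rfl, hSi⟩)
  · rintro ⟨hA, h⟩
    refine ⟨hA, fun j hSj => ?_⟩
    rcases (F.mem_relabel_V g).1 hSj with hA' | ⟨i, _, hSi⟩
    · exact hA hA'
    · exact h i hSi

/-- Relabelling preserves equality of labels. [this work] -/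
theorem relabel_lab_eq_of_lab_eq {S T : Finset α} (h : F.lab S = F.lab T) : (F.relabel g).lab S = (F.relabel g).lab T := by
  rcases F.lab_cases S with hA | h0 | ⟨i, hAS, hiS, hS⟩
  · have hT : T ∈ F.A := (F.lab_eq_last_iff T).1 (h ▸ (F.lab_eq_last_iff S).2 hA)
    rw [((F.relabel g).lab_eq_last_iff S).2 hA, ((F.relabel g).lab_eq_last_iff T).2 hT]
  · have hT : F.lab T = 0 := h ▸ h0
    rw [(F.relabel_lab_eq_zero_iff g S).2 h0, (F.relabel_lab_eq_zero_iff g T).2 hT]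
  · rw [hS] at h
    rcases F.lab_cases T with hAT | h0T | ⟨i', hAT, hiT, hT⟩
    · exact absurd ((F.lab_eq_last_iff T).2 hAT) (h ▸ petalLab_ne_last k i)
    · exact absurd h0T (h ▸ petalLab_ne_zero k i)
    · rw [hT] at h
      have hii' : i = i' := petalLab_injective k h
      subst hii'
      have hS' : (F.relabel g).lab S = petalLab k' (g i) :=
        (F.relabel g).lab_eq_petalLab hAS ((F.mem_relabel_V g).2 (Or.inr ⟨i, rfl, hiS⟩))
      have hT' : (F.relabel g).lab T = petalLab k' (g i) :=
        (F.relabel g).lab_eq_petalLab hAT ((F.mem_relabel_V g).2 (Or.inr ⟨i, rfl, hiT⟩))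
      rw [hS', hT']

variable [Fintype α]

/-- **Relabelling monotonicity**: merging petal colours never decreases the partition functional; the finest petal structure is the
strongest instance of ★ₖ. [this work] -/
theorem ZK_le_ZK_relabel : F.ZK ≤ (F.relabel g).ZK := by
  unfold ZK
  refine sum_le_sum fun q _ => ?_
  exact s6K_le_of_relabel
    ((F.relabel_lab_eq_last_iff g _).symm) ((F.relabel_lab_eq_zero_iff g _).symm)
    ((F.relabel_lab_eq_last_iff g _).symm) ((F.relabel_lab_eq_zero_iff g _).symm)
    ((F.relabel_lab_eq_last_iff g _).symm) ((F.relabel_lab_eq_zero_iff g _).symm)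
    (F.relabel_lab_eq_of_lab_eq g) (F.relabel_lab_eq_of_lab_eq g) (F.relabel_lab_eq_of_lab_eq g)

end MSunflower

/-! ## The `(A, B, χ)` description -/

namespace MSunflower

variable [Fintype α] {k : ℕ}

/-- **`(A,B,χ)` form.**  An up-set `A`, a down-set `B` (disjoint from `A` in the intended use), and a colouring `c` of the middle zone `2^α ∖ (A ∪ B)` that is
constant along inclusions inside the middle zone (equivalently: constant on the connected components of its Hasse graph) define a
monotone map into `M_k`. [this work] -/
def ofColouring (A B : Finset (Finset α)) (c : Finset α → Fin k) (hA : IsUpperSet (A : Set (Finset α)))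
    (hB : IsLowerSet (B : Set (Finset α)))
    (hc : ∀ S T, S ⊆ T → S ∉ A → S ∉ B → T ∉ A → T ∉ B → c S = c T) : MSunflower k α where
  V := fun i => A ∪ Finset.univ.filter fun S => S ∉ A ∧ S ∉ B ∧ c S = i
  A := A
  upperV := by
    intro i S T hST hS
    have hS' : S ∈ A ∪ Finset.univ.filter (fun S => S ∉ A ∧ S ∉ B ∧ c S = i) := hS
    show T ∈ A ∪ Finset.univ.filter (fun S => S ∉ A ∧ S ∉ B ∧ c S = i)
    rw [mem_union, mem_filter] at hS' ⊢
    rcases hS' with hSA | ⟨_, hSA, hSB, hSc⟩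
    · exact Or.inl (hA hST hSA)
    · by_cases hTA : T ∈ A
      · exact Or.inl hTA
      · have hTB : T ∉ B := fun hTB => hSB (hB hST hTB)
        exact Or.inr ⟨mem_univ _, hTA, hTB, (hc S T hST hSA hSB hTA hTB) ▸ hSc⟩
  upperA := hA
  A_sub := fun _ => subset_union_left
  inter_sub := by
    intro i j hij S hS
    rw [mem_inter, mem_union, mem_union, mem_filter, mem_filter] at hS
    rcases hS with ⟨hSA | ⟨_, _, _, hi⟩, hSA' | ⟨_, _, _, hj⟩⟩
    · exact hSA
    · exact hSA
    · exact hSA'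
    · exact absurd (hi.symm.trans hj) hij

end MSunflower

end Summit.CriticalPhenomena.PercolationContinuityZ3.Theorems.SunflowerPartition
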